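import Mathlib
import Summits.Ventures.PercRepro2.Defs
import Summits.Ventures.PercRepro2.Independence
import Summits.Ventures.PercRepro2.Harris
import Summits.Ventures.PercRepro2.Graph
import Summits.Ventures.PercRepro2.Exploration
import Summits.Ventures.PercRepro2.Events
import Summits.Ventures.PercRepro2.FourFunctions
import Summits.Ventures.PercRepro2.Induced
import Summits.Ventures.PercRepro2.Frontier
import Summits.Ventures.PercRepro2.ObsIndependence
import Summits.Ventures.PercRepro2.BHK
import Summits.Ventures.PercRepro2.BHKEvents
import Summits.Ventures.PercRepro2.OrderPreservation
import Summits.Ventures.PercRepro2.OrderPreservationDual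
import Summits.Ventures.PercRepro2.VdBKahn
import Summits.Ventures.PercRepro2.BHKAvoid
import Summits.Ventures.PercRepro2.R2PrimeThreeReduction
import Summits.Ventures.PercRepro2.YBridge
import Summits.Ventures.PercRepro2.Yu1Functionals
import Summits.Ventures.PercRepro2.Yu1Events
import Summits.Ventures.PercRepro2.Yu1
import Summits.Ventures.PercRepro2.LBSplit
import Summits.Ventures.PercRepro2.YDelta
import Summits.Ventures.PercRepro2.SD
import Summits.Ventures.PercRepro2.Lambda
import Summits.Ventures.PercRepro2.LambdaTau

/-!
# The exact `λ < 1` decomposition of the (Yu1Δ)-slack (blind cell PercRepro2, typer-1;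
lead g6 ADDENDUM 15 (5), INBOX 2026-08-22T22:39:03Z (T2))

With `τ, τ₀, τ₁` of `LambdaTau`: the (Yu1Δ)-slack is `E[1_o τ; R]` (`slack_eq_expect_tau`),
`E[τ; R] = 0` (`expect_tau_eq_zero`), `E[τ₀; R] = −(P(PD) − W) r_b` (`expect_tau0_eq`), and the
**exact, division-free identity** for every `F` (`slack_decomp`):
`E[F τ; R] · P(R) = [E[F τ₀; R] P(R) − E[F; R] E[τ₀; R]] + (P(PD) − W) (P(R) E[F 1_b(1−u); R] − E[F; R] r_b)`;
the bracket is `≥ 0` by BHK 1.1 for increasing `F ≥ 0` (`bracket_nonneg`), so in the regime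
`W ≤ P(PD)` the open content of (Yu1Δ) is the lower bound
`(P(PD) − W) (E[1_o; R] r_b − P(R) A′) ≤ bracket` (`Yu1Delta_iff_bracket`), i.e. the covariance
form `Cov_R(1_o, τ₁) ≥ (P(PD) − W) Cov_R(1_o, 1_b u)` (`Yu1Delta_iff_cov_tau1`, cleared by `P(R)²`).
-/

namespace Summit.Ventures.PercRepro2

open UnionCluster Yu1

namespace Lambda

section SlackDecomposition

variable {V : Type*} {E : Type*} [Fintype E] [DecidableEq E] [Fintype V] [DecidableEq V]
  {R : Type*} [Field R] [LinearOrder R] [IsStrictOrderedRing R]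

omit [LinearOrder R] [IsStrictOrderedRing R] in
/-- **The (Yu1Δ)-slack is `E[1_o τ; R]`**:
`P(PD, o ∈ C₁) W + Δ_l P(PD) − T_{l→h} P(PD) = E[1_o(C₁) τ(C₁); R]`. -/
theorem slack_eq_expect_tau (p : E → R) (ends : E → Sym2 V) (o a₁ a₂ a₃ b : V) :
    prob p (PDEvent ends a₁ a₂ a₃ ∩ connEvent ends a₁ o) *
          (massM2 p ends a₁ a₂ a₃ b + deltaT p ends a₁ a₂ a₃ b) +
        deltaL p ends o a₁ a₂ a₃ b * prob p (PDEvent ends a₁ a₂ a₃) -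
      prob p (PDEvent ends a₁ a₂ a₃ ∩ connEvent ends a₁ o ∩ connEvent ends a₂ b) *
        prob p (PDEvent ends a₁ a₂ a₃) =
      expect p (fun ω => ind o (cluster ends ω a₁) * tau p ends a₁ a₂ a₃ b (cluster ends ω a₁) *
        (avoidAll ends a₁ {a₂, a₃}).indicator 1 ω) := by
  have hT : prob p (PDEvent ends a₁ a₂ a₃ ∩ connEvent ends a₁ o ∩ connEvent ends a₂ b) -
      deltaL p ends o a₁ a₂ a₃ b =
      expect p (fun ω => ind o (cluster ends ω a₁) * psi p ends a₂ a₃ b (cluster ends ω a₁) *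
        (avoidAll ends a₁ {a₂, a₃}).indicator 1 ω) := by
    rw [Tlh_sub_deltaL, tower_ob, tower_obT]
    unfold expect
    rw [← Finset.sum_sub_distrib]
    refine Finset.sum_congr rfl fun ω _ => ?_
    unfold psi
    ring
  have hC := tower_PDo p ends o a₁ a₂ a₃
  have key : expect p (fun ω => ind o (cluster ends ω a₁) * tau p ends a₁ a₂ a₃ b (cluster ends ω a₁) *
      (avoidAll ends a₁ {a₂, a₃}).indicator 1 ω) =
      (massM2 p ends a₁ a₂ a₃ b + deltaT p ends a₁ a₂ a₃ b) *
          expect p (fun ω => ind o (cluster ends ω a₁) * u p ends a₂ a₃ (cluster ends ω a₁) *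
            (avoidAll ends a₁ {a₂, a₃}).indicator 1 ω) +
        (-prob p (PDEvent ends a₁ a₂ a₃)) *
          expect p (fun ω => ind o (cluster ends ω a₁) * psi p ends a₂ a₃ b (cluster ends ω a₁) *
            (avoidAll ends a₁ {a₂, a₃}).indicator 1 ω) := by
    apply expect_comb
    intro ω
    unfold tau
    ring
  rw [key, ← hC, ← hT]
  ring

omit [LinearOrder R] [IsStrictOrderedRing R] in
/-- **`E[τ; R] = 0`**. -/
theorem expect_tau_eq_zero (p : E → R) (ends : E → Sym2 V) (a₁ a₂ a₃ b : V) :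
    expect p (fun ω => tau p ends a₁ a₂ a₃ b (cluster ends ω a₁) *
      (avoidAll ends a₁ {a₂, a₃}).indicator 1 ω) = 0 := by
  have key : expect p (fun ω => tau p ends a₁ a₂ a₃ b (cluster ends ω a₁) *
      (avoidAll ends a₁ {a₂, a₃}).indicator 1 ω) =
      (massM2 p ends a₁ a₂ a₃ b + deltaT p ends a₁ a₂ a₃ b) *
          expect p (fun ω => u p ends a₂ a₃ (cluster ends ω a₁) *
            (avoidAll ends a₁ {a₂, a₃}).indicator 1 ω) +
        (-prob p (PDEvent ends a₁ a₂ a₃)) *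
          expect p (fun ω => psi p ends a₂ a₃ b (cluster ends ω a₁) *
            (avoidAll ends a₁ {a₂, a₃}).indicator 1 ω) := by
    apply expect_comb
    intro ω
    unfold tau
    ring
  rw [key, expect_u_eq, expect_psi_eq]
  ring

omit [LinearOrder R] [IsStrictOrderedRing R] in
/-- `E[τ₀; R] = −(P(PD) − W) r_b`, `r_b = E[1_b (1 − u); R]`. -/
theorem expect_tau0_eq (p : E → R) (ends : E → Sym2 V) (a₁ a₂ a₃ b : V) :
    expect p (fun ω => tau0 p ends a₁ a₂ a₃ b (cluster ends ω a₁) *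
        (avoidAll ends a₁ {a₂, a₃}).indicator 1 ω) =
      -((prob p (PDEvent ends a₁ a₂ a₃) - (massM2 p ends a₁ a₂ a₃ b + deltaT p ends a₁ a₂ a₃ b)) *
        expect p (fun ω => ind b (cluster ends ω a₁) * (1 - u p ends a₂ a₃ (cluster ends ω a₁)) *
          (avoidAll ends a₁ {a₂, a₃}).indicator 1 ω)) := by
  have key : expect p (fun ω => tau0 p ends a₁ a₂ a₃ b (cluster ends ω a₁) *
      (avoidAll ends a₁ {a₂, a₃}).indicator 1 ω) =
      (1 : R) * expect p (fun ω => tau p ends a₁ a₂ a₃ b (cluster ends ω a₁) *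
          (avoidAll ends a₁ {a₂, a₃}).indicator 1 ω) +
        (-(prob p (PDEvent ends a₁ a₂ a₃) -
            (massM2 p ends a₁ a₂ a₃ b + deltaT p ends a₁ a₂ a₃ b))) *
          expect p (fun ω => ind b (cluster ends ω a₁) * (1 - u p ends a₂ a₃ (cluster ends ω a₁)) *
            (avoidAll ends a₁ {a₂, a₃}).indicator 1 ω) := by
    apply expect_comb
    intro ω
    unfold tau0
    ring
  rw [key, expect_tau_eq_zero]
  ring

omit [Fintype V] [LinearOrder R] [IsStrictOrderedRing R] in
/-- `E[F τ; R] = E[F τ₀; R] + (P(PD) − W) E[F 1_b (1 − u); R]` for every `F`. -/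
theorem expect_tau_split (p : E → R) (ends : E → Sym2 V) (a₁ a₂ a₃ b : V) (F : Config E → R) :
    expect p (fun ω => F ω * tau p ends a₁ a₂ a₃ b (cluster ends ω a₁) *
        (avoidAll ends a₁ {a₂, a₃}).indicator 1 ω) =
      expect p (fun ω => F ω * tau0 p ends a₁ a₂ a₃ b (cluster ends ω a₁) *
          (avoidAll ends a₁ {a₂, a₃}).indicator 1 ω) +
        (prob p (PDEvent ends a₁ a₂ a₃) - (massM2 p ends a₁ a₂ a₃ b + deltaT p ends a₁ a₂ a₃ b)) *
          expect p (fun ω => F ω * (ind b (cluster ends ω a₁) *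
            (1 - u p ends a₂ a₃ (cluster ends ω a₁))) * (avoidAll ends a₁ {a₂, a₃}).indicator 1 ω) := by
  have key : expect p (fun ω => F ω * tau p ends a₁ a₂ a₃ b (cluster ends ω a₁) *
      (avoidAll ends a₁ {a₂, a₃}).indicator 1 ω) =
      (1 : R) * expect p (fun ω => F ω * tau0 p ends a₁ a₂ a₃ b (cluster ends ω a₁) *
          (avoidAll ends a₁ {a₂, a₃}).indicator 1 ω) +
        (prob p (PDEvent ends a₁ a₂ a₃) - (massM2 p ends a₁ a₂ a₃ b + deltaT p ends a₁ a₂ a₃ b)) *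
          expect p (fun ω => F ω * (ind b (cluster ends ω a₁) *
            (1 - u p ends a₂ a₃ (cluster ends ω a₁))) * (avoidAll ends a₁ {a₂, a₃}).indicator 1 ω) := by
    apply expect_comb
    intro ω
    unfold tau0
    ring
  rw [key, one_mul]

omit [LinearOrder R] [IsStrictOrderedRing R] in
/-- **The exact, division-free `λ < 1` decomposition** (ADDENDUM 15 (5)), for every `F`:
`E[F τ; R] · P(R) = [E[F τ₀; R] P(R) − E[F; R] E[τ₀; R]]
  + (P(PD) − W) · (P(R) · E[F 1_b(1 − u); R] − E[F; R] · r_b)`. -/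
theorem slack_decomp (p : E → R) (ends : E → Sym2 V) (a₁ a₂ a₃ b : V) (F : Config E → R) :
    expect p (fun ω => F ω * tau p ends a₁ a₂ a₃ b (cluster ends ω a₁) *
        (avoidAll ends a₁ {a₂, a₃}).indicator 1 ω) * prob p (avoidAll ends a₁ {a₂, a₃}) =
      (expect p (fun ω => F ω * tau0 p ends a₁ a₂ a₃ b (cluster ends ω a₁) *
            (avoidAll ends a₁ {a₂, a₃}).indicator 1 ω) * prob p (avoidAll ends a₁ {a₂, a₃}) -
          expect p (fun ω => F ω * (avoidAll ends a₁ {a₂, a₃}).indicator 1 ω) *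
            expect p (fun ω => tau0 p ends a₁ a₂ a₃ b (cluster ends ω a₁) *
              (avoidAll ends a₁ {a₂, a₃}).indicator 1 ω)) +
        (prob p (PDEvent ends a₁ a₂ a₃) - (massM2 p ends a₁ a₂ a₃ b + deltaT p ends a₁ a₂ a₃ b)) *
          (prob p (avoidAll ends a₁ {a₂, a₃}) *
              expect p (fun ω => F ω * (ind b (cluster ends ω a₁) *
                (1 - u p ends a₂ a₃ (cluster ends ω a₁))) * (avoidAll ends a₁ {a₂, a₃}).indicator 1 ω) -
            expect p (fun ω => F ω * (avoidAll ends a₁ {a₂, a₃}).indicator 1 ω) *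
              expect p (fun ω => ind b (cluster ends ω a₁) * (1 - u p ends a₂ a₃ (cluster ends ω a₁)) *
                (avoidAll ends a₁ {a₂, a₃}).indicator 1 ω)) := by
  rw [expect_tau_split, expect_tau0_eq]
  ring

/-- **The bracket is non-negative** (BHK 1.1: `F ∘ C₁` increasing and `≥ 0`, `τ₀ + P(PD)`
increasing and `≥ 0`): `E[F; R] · E[τ₀; R] ≤ E[F τ₀; R] · P(R)` (`b ≠ a₂`, `0 ≤ W`). -/
theorem bracket_nonneg (p : E → R) (hp : IsProbVec p) (ends : E → Sym2 V) (a₁ a₂ a₃ b : V)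
    (hb : b ≠ a₂) (hW : 0 ≤ massM2 p ends a₁ a₂ a₃ b + deltaT p ends a₁ a₂ a₃ b)
    {F : Set V → R} (hF : Monotone F) (hF0 : ∀ S, 0 ≤ F S) :
    expect p (fun ω => F (cluster ends ω a₁) * (avoidAll ends a₁ {a₂, a₃}).indicator 1 ω) *
        expect p (fun ω => tau0 p ends a₁ a₂ a₃ b (cluster ends ω a₁) *
          (avoidAll ends a₁ {a₂, a₃}).indicator 1 ω) ≤
      expect p (fun ω => F (cluster ends ω a₁) * tau0 p ends a₁ a₂ a₃ b (cluster ends ω a₁) *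
        (avoidAll ends a₁ {a₂, a₃}).indicator 1 ω) * prob p (avoidAll ends a₁ {a₂, a₃}) := by
  have h := bhk_induced p hp ends a₁ (F₁ := F)
    (F₂ := fun S => tau0 p ends a₁ a₂ a₃ b S + prob p (PDEvent ends a₁ a₂ a₃)) hF
    (fun S S' hSS' => by
      show tau0 p ends a₁ a₂ a₃ b S + prob p (PDEvent ends a₁ a₂ a₃) ≤
        tau0 p ends a₁ a₂ a₃ b S' + prob p (PDEvent ends a₁ a₂ a₃)
      have := tau0_mono p hp ends a₁ a₂ a₃ b hb hW hSS'
      linarith) hF0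
    (fun S => by
      have := tau0_ge p hp ends a₁ a₂ a₃ b hb hW S
      linarith)
    Finset.univ {a₂, a₃} {a₂, a₃} (Finset.subset_univ _) (Finset.subset_univ _)
  simp only [REvent_univ, Finset.inter_self, Finset.union_self, expect_clusterObs_univ,
    Pi.mul_apply] at h
  have e1 : expect p (fun ω => (tau0 p ends a₁ a₂ a₃ b (cluster ends ω a₁) +
      prob p (PDEvent ends a₁ a₂ a₃)) * (avoidAll ends a₁ {a₂, a₃}).indicator 1 ω) =
      (1 : R) * expect p (fun ω => tau0 p ends a₁ a₂ a₃ b (cluster ends ω a₁) *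
          (avoidAll ends a₁ {a₂, a₃}).indicator 1 ω) +
        prob p (PDEvent ends a₁ a₂ a₃) *
          expect p (fun ω => (avoidAll ends a₁ {a₂, a₃}).indicator 1 ω) := by
    apply expect_comb
    intro ω
    ring
  have e2 : expect p (fun ω => F (cluster ends ω a₁) * (tau0 p ends a₁ a₂ a₃ b (cluster ends ω a₁) +
      prob p (PDEvent ends a₁ a₂ a₃)) * (avoidAll ends a₁ {a₂, a₃}).indicator 1 ω) =
      (1 : R) * expect p (fun ω => F (cluster ends ω a₁) *
          tau0 p ends a₁ a₂ a₃ b (cluster ends ω a₁) * (avoidAll ends a₁ {a₂, a₃}).indicator 1 ω) +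
        prob p (PDEvent ends a₁ a₂ a₃) *
          expect p (fun ω => F (cluster ends ω a₁) * (avoidAll ends a₁ {a₂, a₃}).indicator 1 ω) := by
    apply expect_comb
    intro ω
    ring
  have e3 : expect p (fun ω => (avoidAll ends a₁ {a₂, a₃}).indicator (1 : Config E → R) ω) =
      prob p (avoidAll ends a₁ {a₂, a₃}) := (prob_eq_expect_indicator p _).symm
  rw [e1, e2, e3] at h
  nlinarith [h]

/-- **(Yu1Δ) in the regime, as a lower bound on the BHK bracket**: with `P(R) > 0`,
`Yu1Delta ↔ (P(PD) − W) · (E[1_o; R] · r_b − P(R) · A′) ≤ E[1_o τ₀; R] P(R) − E[1_o; R] E[τ₀; R]`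
(`A′ = E[1_o 1_b (1 − u); R] = P(o ∈ C₁, b ∈ C₁, T)`). -/
theorem Yu1Delta_iff_bracket (p : E → R) (ends : E → Sym2 V) (o a₁ a₂ a₃ b : V)
    (hR : 0 < prob p (avoidAll ends a₁ {a₂, a₃})) :
    Yu1Delta p ends o a₁ a₂ a₃ b ↔
      (prob p (PDEvent ends a₁ a₂ a₃) - (massM2 p ends a₁ a₂ a₃ b + deltaT p ends a₁ a₂ a₃ b)) *
          (expect p (fun ω => ind o (cluster ends ω a₁) * (avoidAll ends a₁ {a₂, a₃}).indicator 1 ω) *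
              expect p (fun ω => ind b (cluster ends ω a₁) * (1 - u p ends a₂ a₃ (cluster ends ω a₁)) *
                (avoidAll ends a₁ {a₂, a₃}).indicator 1 ω) -
            prob p (avoidAll ends a₁ {a₂, a₃}) *
              expect p (fun ω => ind o (cluster ends ω a₁) * (ind b (cluster ends ω a₁) *
                (1 - u p ends a₂ a₃ (cluster ends ω a₁))) * (avoidAll ends a₁ {a₂, a₃}).indicator 1 ω)) ≤
        expect p (fun ω => ind o (cluster ends ω a₁) * tau0 p ends a₁ a₂ a₃ b (cluster ends ω a₁) *
              (avoidAll ends a₁ {a₂, a₃}).indicator 1 ω) * prob p (avoidAll ends a₁ {a₂, a₃}) -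
          expect p (fun ω => ind o (cluster ends ω a₁) * (avoidAll ends a₁ {a₂, a₃}).indicator 1 ω) *
            expect p (fun ω => tau0 p ends a₁ a₂ a₃ b (cluster ends ω a₁) *
              (avoidAll ends a₁ {a₂, a₃}).indicator 1 ω) := by
  have hslack := slack_eq_expect_tau p ends o a₁ a₂ a₃ b
  have hdec := slack_decomp p ends a₁ a₂ a₃ b (fun ω => ind o (cluster ends ω a₁))
  unfold Yu1Delta
  constructor
  · intro h
    have h0 : 0 ≤ expect p (fun ω => ind o (cluster ends ω a₁) *
        tau p ends a₁ a₂ a₃ b (cluster ends ω a₁) * (avoidAll ends a₁ {a₂, a₃}).indicator 1 ω) := by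
      rw [← hslack]
      linarith
    have h1 : 0 ≤ expect p (fun ω => ind o (cluster ends ω a₁) *
        tau p ends a₁ a₂ a₃ b (cluster ends ω a₁) * (avoidAll ends a₁ {a₂, a₃}).indicator 1 ω) *
        prob p (avoidAll ends a₁ {a₂, a₃}) := mul_nonneg h0 hR.le
    rw [hdec] at h1
    linarith
  · intro h
    have h1 : 0 ≤ expect p (fun ω => ind o (cluster ends ω a₁) *
        tau p ends a₁ a₂ a₃ b (cluster ends ω a₁) * (avoidAll ends a₁ {a₂, a₃}).indicator 1 ω) *
        prob p (avoidAll ends a₁ {a₂, a₃}) := by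
      rw [hdec]
      linarith
    have h0 : 0 ≤ expect p (fun ω => ind o (cluster ends ω a₁) *
        tau p ends a₁ a₂ a₃ b (cluster ends ω a₁) * (avoidAll ends a₁ {a₂, a₃}).indicator 1 ω) :=
      nonneg_of_mul_nonneg_left h1 hR
    rw [← hslack] at h0
    linarith

omit [Fintype V] [LinearOrder R] [IsStrictOrderedRing R] in
/-- `E[F τ₁; R] = E[F τ₀; R] + (P(PD) − W) E[F 1_b; R]`. -/
theorem expect_tau1_split (p : E → R) (ends : E → Sym2 V) (a₁ a₂ a₃ b : V) (F : Config E → R) :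
    expect p (fun ω => F ω * tau1 p ends a₁ a₂ a₃ b (cluster ends ω a₁) *
        (avoidAll ends a₁ {a₂, a₃}).indicator 1 ω) =
      expect p (fun ω => F ω * tau0 p ends a₁ a₂ a₃ b (cluster ends ω a₁) *
          (avoidAll ends a₁ {a₂, a₃}).indicator 1 ω) +
        (prob p (PDEvent ends a₁ a₂ a₃) - (massM2 p ends a₁ a₂ a₃ b + deltaT p ends a₁ a₂ a₃ b)) *
          expect p (fun ω => F ω * ind b (cluster ends ω a₁) *
            (avoidAll ends a₁ {a₂, a₃}).indicator 1 ω) := by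
  have key : expect p (fun ω => F ω * tau1 p ends a₁ a₂ a₃ b (cluster ends ω a₁) *
      (avoidAll ends a₁ {a₂, a₃}).indicator 1 ω) =
      (1 : R) * expect p (fun ω => F ω * tau0 p ends a₁ a₂ a₃ b (cluster ends ω a₁) *
          (avoidAll ends a₁ {a₂, a₃}).indicator 1 ω) +
        (prob p (PDEvent ends a₁ a₂ a₃) - (massM2 p ends a₁ a₂ a₃ b + deltaT p ends a₁ a₂ a₃ b)) *
          expect p (fun ω => F ω * ind b (cluster ends ω a₁) *
            (avoidAll ends a₁ {a₂, a₃}).indicator 1 ω) := by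
    apply expect_comb
    intro ω
    unfold tau1
    ring
  rw [key, one_mul]

/-- **(Yu1Δ) as a covariance ratio** (ADDENDUM 15 (5), cleared by `P(R)`): with `P(R) > 0`,
`Yu1Delta ↔ (P(PD) − W) · (P(R) E[1_o 1_b u; R] − E[1_o; R] E[1_b u; R])
  ≤ P(R) E[1_o τ₁; R] − E[1_o; R] E[τ₁; R]`, i.e. `Cov_R(1_o, τ₁) ≥ (P(PD) − W) Cov_R(1_o, 1_b u)`. -/
theorem Yu1Delta_iff_cov_tau1 (p : E → R) (ends : E → Sym2 V) (o a₁ a₂ a₃ b : V)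
    (hR : 0 < prob p (avoidAll ends a₁ {a₂, a₃})) :
    Yu1Delta p ends o a₁ a₂ a₃ b ↔
      (prob p (PDEvent ends a₁ a₂ a₃) - (massM2 p ends a₁ a₂ a₃ b + deltaT p ends a₁ a₂ a₃ b)) *
          (prob p (avoidAll ends a₁ {a₂, a₃}) *
              expect p (fun ω => ind o (cluster ends ω a₁) * (ind b (cluster ends ω a₁) *
                u p ends a₂ a₃ (cluster ends ω a₁)) * (avoidAll ends a₁ {a₂, a₃}).indicator 1 ω) -
            expect p (fun ω => ind o (cluster ends ω a₁) * (avoidAll ends a₁ {a₂, a₃}).indicator 1 ω) *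
              expect p (fun ω => ind b (cluster ends ω a₁) * u p ends a₂ a₃ (cluster ends ω a₁) *
                (avoidAll ends a₁ {a₂, a₃}).indicator 1 ω)) ≤
        prob p (avoidAll ends a₁ {a₂, a₃}) *
            expect p (fun ω => ind o (cluster ends ω a₁) * tau1 p ends a₁ a₂ a₃ b (cluster ends ω a₁) *
              (avoidAll ends a₁ {a₂, a₃}).indicator 1 ω) -
          expect p (fun ω => ind o (cluster ends ω a₁) * (avoidAll ends a₁ {a₂, a₃}).indicator 1 ω) *
            expect p (fun ω => tau1 p ends a₁ a₂ a₃ b (cluster ends ω a₁) *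
              (avoidAll ends a₁ {a₂, a₃}).indicator 1 ω) := by
  rw [Yu1Delta_iff_bracket p ends o a₁ a₂ a₃ b hR]
  rw [expect_tau1_split p ends a₁ a₂ a₃ b (fun ω => ind o (cluster ends ω a₁))]
  have e0 : expect p (fun ω => tau1 p ends a₁ a₂ a₃ b (cluster ends ω a₁) *
      (avoidAll ends a₁ {a₂, a₃}).indicator 1 ω) =
      expect p (fun ω => tau0 p ends a₁ a₂ a₃ b (cluster ends ω a₁) *
          (avoidAll ends a₁ {a₂, a₃}).indicator 1 ω) +
        (prob p (PDEvent ends a₁ a₂ a₃) - (massM2 p ends a₁ a₂ a₃ b + deltaT p ends a₁ a₂ a₃ b)) *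
          expect p (fun ω => ind b (cluster ends ω a₁) * (avoidAll ends a₁ {a₂, a₃}).indicator 1 ω) := by
    have := expect_tau1_split p ends a₁ a₂ a₃ b (fun _ => (1 : R))
    simpa only [one_mul] using this
  -- `1_b (1 − u) = 1_b − 1_b u` under the expectations
  have e1 : expect p (fun ω => ind o (cluster ends ω a₁) * (ind b (cluster ends ω a₁) *
      (1 - u p ends a₂ a₃ (cluster ends ω a₁))) * (avoidAll ends a₁ {a₂, a₃}).indicator 1 ω) =
      (1 : R) * expect p (fun ω => ind o (cluster ends ω a₁) * ind b (cluster ends ω a₁) *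
          (avoidAll ends a₁ {a₂, a₃}).indicator 1 ω) +
        (-1 : R) * expect p (fun ω => ind o (cluster ends ω a₁) * (ind b (cluster ends ω a₁) *
          u p ends a₂ a₃ (cluster ends ω a₁)) * (avoidAll ends a₁ {a₂, a₃}).indicator 1 ω) := by
    apply expect_comb
    intro ω
    ring
  have e2 : expect p (fun ω => ind b (cluster ends ω a₁) * (1 - u p ends a₂ a₃ (cluster ends ω a₁)) *
      (avoidAll ends a₁ {a₂, a₃}).indicator 1 ω) =
      (1 : R) * expect p (fun ω => ind b (cluster ends ω a₁) *
          (avoidAll ends a₁ {a₂, a₃}).indicator 1 ω) +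
        (-1 : R) * expect p (fun ω => ind b (cluster ends ω a₁) * u p ends a₂ a₃ (cluster ends ω a₁) *
          (avoidAll ends a₁ {a₂, a₃}).indicator 1 ω) := by
    apply expect_comb
    intro ω
    ring
  rw [e0, e1, e2]
  constructor
  · intro h
    linarith
  · intro h
    linarith

end SlackDecomposition

end Lambda

end Summit.Ventures.PercRepro2
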